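/-
Copyright: cell pub-balaban-gaps (YM BLITZ Y1, track G1), seat g1-p2 GEN 8 (unit `pub-balaban-gaps-g1-p2`).  Row (D4) NODE O,
OBJECT ∕ MECHANISM level, CARRIER-GENERIC: [B9] Cor. 3.5's step for the covariant shift PLUS A COVARIANT-AVERAGING CORRECTION under
print's LEVEL-DEPENDENT windows.  Print's operator in Cor. 3.5 is `G(U′)` with the COVARIANT averages `Q′_j(U′)` (p. 407, (3.78)); the
difference `Σ_j a_j(L^jη)^{−2}(Q′_j(U′)*Q′_j(U′) − Q′_j*Q′_j)1_{Λ_j}` is, at print's scaling, a CUBE-LOCAL operator `Ã(u)` with bounded row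
sums composed with the weight `w² ⊗ 1` (`w = (L^{j}η)^{−1}` on `Ω_j`): `V_av = Ã·(w² ⊗ 1)`.  This file adds that slot to
`D4WalkBlockShiftWeighted`: the augmented domination letter (`α′ ↦ α′ + α_av` on the `w²` member of the weighted family), holomorphy,
and Cor. 3.5's step — constants uniform.  HONEST FRAMING: elementary; `Ã` is a hypothesis SHAPE (the nested-family instance from posited
block transporters is `D4WalkBlockCovariantAveragingMultiLevel`); (D4) NOT discharged (instance 0∕1); NOT BetaPertH, NOT continuum, NOT Clay.
-/
import Summits.QuantumFields.BalabanUV.Gaps.D4WalkBlockShiftWeighted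
import Summits.QuantumFields.BalabanUV.Gaps.D4WalkBlockShiftTransport
import Summits.QuantumFields.BalabanUV.Gaps.D4WalkBlockLettersNeumann

/-!
# `Gaps.D4WalkBlockShiftWeightedAv` — the covariant shift plus a weighted cube-local averaging correction `Ã·(w² ⊗ 1)`:
# domination letter and Cor. 3.5's step (carrier-generic; cell pub-balaban-gaps, seat g1-p2 gen 8)

HONEST DEPENDENCY (cell pub-balaban, verbatim): continuum YM on T⁴ ⇐ BetaPertH ∧ nine spine estimates (0/9 proved);
BetaPertH ⇐ (D1) ∧ (D4) ∧ CAP+tail.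

Data: as `D4WalkBlockShiftWeighted` (finite carrier `X`, fibre `F`, cube map, shift permutations, `η > 0`, site weight `w > 0` with
neighbour ratio `Λ`), plus a holomorphic family `Ã(u)` of CUBE-LOCAL matrices on `X × F` (`Ã(u)_{pq} ≠ 0 ⟹ cub p = cub q`) with full row
sums `Σ_q‖Ã(u)_{pq}‖ ≤ α_av` on the ball.  The perturbation is `V(u) = V_W(u) + Ã(u)·(w² ⊗ 1)`.
* §0 `wOp_eq_diagonal` (`w ⊗ 1 = diag w`), `mul_wOp_apply`;
* **`covShiftWAv_dominated`**: `‖V(u)S‖_{Y,Y′} ≤ 0·‖S‖ + Σ_j covAlphaW α (α′ + α_av) j·‖D̃_jS‖_{Y,Y′}` (the averaging correction lands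
  on the `w²` member of the weighted family `covDopW` — print's (3.61) `(L^jη)^{−2}|λ|` slot);
* `covShiftWAv_holo`;
* §3 (`norm_le_of_blockLetters`, `isUnit_one_sub_of_blockLetters`: the shared `D4WalkBlockLettersNeumann`), `one_le_of_rowSum`,
  **`isUnit_covShiftWAv_of_letters`** (`1 − V(u)G` is invertible on the ball under the same letters, windows, row sum and margin);
* **`blockWalkExpansion_covShiftWAv_of_letters`** — COR. 3.5's STEP: for any kernel `G` with the value letter `Ce^{−ρd₁}` and the
  WEIGHTED letters `‖(w² ⊗ 1)G‖, ‖(w ⊗ 1)(∂_μ ⊗ 1)G‖ ≤ Ce^{−ρd₁}`, windows `ηα·w` (bond), `η²α′·w²` (divergence), the averaging slot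
  `α_av`, cube row sum `(μ, c_μ)`, `2μ ≤ ε`, `2μ ≤ ρ − ε − μ`, margin
  `c_μ(c_μ·1·(1·((0 + Σ_j covAlphaW α (α′ + α_av) j·covBW ρ Λ j)C))c_μ)c_μ < 1`: `G(1 − V(u)G)⁻¹` is a block walk expansion at
  `(ε − 2μ, ρ − ε − 3μ, c_μC(1·(1−q)⁻¹)c_μ, ρ − 2μ)` with the relative letters `covBW ρ Λ` — NO weight, level or `η⁻¹` in any constant.
WHAT IT IS NOT.  A construction of `Q′_j(U′)`; the instance; (D4) instance 0∕1; words of row (D4) UNCHANGED.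

References: T. Bałaban, Comm. Math. Phys. **99** (1985) 389–434 [B9], (3.37) p. 396, Thm 3.1 (3.42) p. 397, (3.61) p. 402, (3.78)
p. 406, Cor. 3.5 p. 407; Comm. Math. Phys. **96** (1984) [4], (2.13)–(2.14) p. 225.
-/

noncomputable section

namespace Summit.QuantumFields.BalabanUV.Gaps.D4WalkBlockShiftWeightedAv

open Metric Set Finset
open scoped Matrix
open Literature.MathematicalPhysics.QuantumFieldTheory.Balaban1983to89
open Literature.MathematicalPhysics.QuantumFieldTheory.Balaban1983to89.B9SectDWalk (DomBy)
open Literature.MathematicalPhysics.QuantumFieldTheory.Balaban1983to89.B9Thm34Ext (toB6)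
open Literature.MathematicalPhysics.QuantumFieldTheory.Balaban1983to89.B9Thm37GlueTorus (torusGeom tdist1 tdist1_self tdist1_nonneg)
open Literature.MathematicalPhysics.QuantumFieldTheory.Balaban1983to89.TreeLengthTorus (TPt)
open Literature.MathematicalPhysics.QuantumFieldTheory.Balaban1983to89.B5TorusCover (UT)
open Literature.MathematicalPhysics.QuantumFieldTheory.Balaban1983to89.B11SectG (RowSum)
open Summit.QuantumFields.BalabanUV.Gaps.D4WalkBlock (rowMass blockNorm blockNorm_add_le rowMass_le_blockNorm BlockWalkExpansion)
open Summit.QuantumFields.BalabanUV.Gaps.D4WalkProduct (differentiableOn_mul_entry)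
open Summit.QuantumFields.BalabanUV.Gaps.D4WalkBlockDerivative (blockNorm_localMul_le blockWalkExpansion_perturb_of_derivLetters)
open Summit.QuantumFields.BalabanUV.Gaps.D4WalkBlockFlatLetters (blockWalkExpansion_const)
open Summit.QuantumFields.BalabanUV.Gaps.D4WalkBlockShiftAlgebra
open Summit.QuantumFields.BalabanUV.Gaps.D4WalkBlockShiftWeighted
open Summit.QuantumFields.BalabanUV.Gaps.D4WalkBlockShiftTransport (blockNorm_rowSum_le)
open Summit.QuantumFields.BalabanUV.Gaps.D4WalkBlockLettersNeumann (norm_le_of_blockLetters isUnit_one_sub_of_blockLetters)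

variable {X : Type} {F : Type}
variable {ν : ℕ} {Kv : Fin ν → ℕ}

/-! ## §0. The weight operator as a diagonal matrix -/

section Diagonal
variable [DecidableEq X] [DecidableEq F]

/-- `w ⊗ 1_F` is the diagonal matrix `diag(w(x))` on `X × F`. -/
theorem wOp_eq_diagonal (w : X → ℝ) : wOp X F w = Matrix.diagonal fun q : X × F => ((w q.1 : ℝ) : ℂ) := by
  ext p q
  unfold wOp fibD
  simp only [Matrix.of_apply, Matrix.smul_apply, Matrix.one_apply, smul_eq_mul, mul_ite, mul_one, mul_zero,
    Matrix.diagonal_apply]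
  by_cases h1 : p.1 = q.1
  · by_cases h2 : p.2 = q.2
    · rw [if_pos h1, if_pos h2, if_pos (Prod.ext h1 h2), h1]
    · rw [if_pos h1, if_neg h2, if_neg (fun h => h2 (congrArg Prod.snd h))]
  · rw [if_neg h1, if_neg (fun h => h1 (congrArg Prod.fst h))]

/-- Columns of `M·(w ⊗ 1)` are the columns of `M` scaled by `w(x′)`. -/
theorem mul_wOp_apply [Fintype X] [Fintype F] (M : Matrix (X × F) (X × F) ℂ) (w : X → ℝ) (p q : X × F) :
    (M * wOp X F w) p q = M p q * ((w q.1 : ℝ) : ℂ) := by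
  rw [wOp_eq_diagonal, Matrix.mul_diagonal]

end Diagonal

/-! ## §1. The augmented domination letter and holomorphy -/

section Dominated
variable [Fintype X] [Fintype F] [DecidableEq X] [DecidableEq F] {ι : Type} [Fintype ι] {sh : ι → X ≃ X} {η : ℝ} {w : X → ℝ}
variable {E : Type*} [NormedAddCommGroup E] [NormedSpace ℂ E]
variable {Wp Wm : ι → E → X → Matrix F F ℂ} {Aav : E → Matrix (X × F) (X × F) ℂ}

omit [NormedSpace ℂ E] in
/-- **THE AUGMENTED WEIGHTED (3.61)-SHAPE LETTER.**  Level-dependent windows (bond `ηα·w`, divergence `η²α′·w²`, `η, w > 0`) and a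
CUBE-LOCAL `Ã(u)` with full row sums `≤ α_av` ⟹ `‖(V_W(u) + Ã(u)(w² ⊗ 1))S‖_{Y,Y′} ≤ 0·‖S‖ + Σ_j covAlphaW α (α′ + α_av) j·‖D̃_jS‖_{Y,Y′}`.
[cite: Balaban1985BackgroundPropagators, (3.61) p.402, (3.78) p.406, (3.37) p.396] -/
theorem covShiftWAv_dominated [∀ i, NeZero (Kv i)] (cub : X → UT Kv) (hη : 0 < η) (hw : ∀ x, 0 < w x) {R α α' αav : ℝ}
    (hα : 0 ≤ α) (hα' : 0 ≤ α') (hαav : 0 ≤ αav)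
    (hWp : ∀ μ, ∀ u ∈ ball (0 : E) R, ∀ x a, ∑ b, ‖Wp μ u x a b‖ ≤ η * α * w x)
    (hWm : ∀ μ, ∀ u ∈ ball (0 : E) R, ∀ x a, ∑ b, ‖Wm μ u x a b‖ ≤ η * α * w x)
    (hdiv : ∀ u ∈ ball (0 : E) R, ∀ x a, ∑ b, ‖(∑ μ, (Wp μ u x + Wm μ u x)) a b‖ ≤ η ^ 2 * α' * w x ^ 2)
    (hloc : ∀ u p q, Aav u p q ≠ 0 → cub p.1 = cub q.1) (hav : ∀ u ∈ ball (0 : E) R, ∀ p, ∑ q, ‖Aav u p q‖ ≤ αav) :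
    ∀ u ∈ ball (0 : E) R, ∀ (S : Matrix (X × F) (X × F) ℂ) (Y Y' : UT Kv),
      blockNorm (fun p : X × F => cub p.1) (fun p : X × F => cub p.1)
          ((covShift X F sh η Wp Wm u + Aav u * wOp X F (fun x => w x ^ 2)) * S) Y Y' ≤
        0 * blockNorm (fun p : X × F => cub p.1) (fun p : X × F => cub p.1) S Y Y' +
          ∑ j, covAlphaW α (α' + αav) j *
            blockNorm (fun p : X × F => cub p.1) (fun p : X × F => cub p.1) (covDopW X F sh η w j * S) Y Y' := by
  intro u hu S Y Y'
  have h1 := covShiftW_dominated (sh := sh) (Wp := Wp) (Wm := Wm) cub hη hw hα hα' hWp hWm hdiv u hu S Y Y'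
  have h2 : blockNorm (fun p : X × F => cub p.1) (fun p : X × F => cub p.1) (Aav u * (wOp X F (fun x => w x ^ 2) * S)) Y Y' ≤
      αav * blockNorm (fun p : X × F => cub p.1) (fun p : X × F => cub p.1) (wOp X F (fun x => w x ^ 2) * S) Y Y' :=
    blockNorm_localMul_le (fun p : X × F => cub p.1) (fun p : X × F => cub p.1) (fun p : X × F => cub p.1) (Aav u) _ (hloc u)
      (fun Y'' => blockNorm_rowSum_le (fun p : X × F => cub p.1) (Aav u) hαav (hav u hu) Y'' Y'') Y Y'
  rw [Matrix.add_mul, Matrix.mul_assoc]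
  refine (blockNorm_add_le _ _ _ _ Y Y').trans ((add_le_add h1 h2).trans (le_of_eq ?_))
  rw [Fintype.sum_sum_type, Fintype.sum_sum_type, Fintype.sum_sum_type, Fintype.sum_sum_type]
  simp only [Finset.univ_unique, Finset.sum_singleton, covAlphaW, covDopW]
  ring

/-- `V_W(u) + Ã(u)(w² ⊗ 1)` is entrywise holomorphic when the defects and `Ã` are. -/
theorem covShiftWAv_holo {R : ℝ} (hWp : ∀ μ x a b, DifferentiableOn ℂ (fun u => Wp μ u x a b) (ball (0 : E) R))
    (hWm : ∀ μ x a b, DifferentiableOn ℂ (fun u => Wm μ u x a b) (ball (0 : E) R))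
    (hAav : ∀ p q, DifferentiableOn ℂ (fun u => Aav u p q) (ball (0 : E) R)) :
    ∀ p q, DifferentiableOn ℂ (fun u => (covShift X F sh η Wp Wm u + Aav u * wOp X F (fun x => w x ^ 2)) p q) (ball (0 : E) R) :=
  fun p q => by
  simp only [Matrix.add_apply]
  exact (covShift_holo hWp hWm p q).add
    (differentiableOn_mul_entry (M₂ := fun _ => wOp X F (fun x => w x ^ 2)) hAav (fun _ _ => differentiableOn_const _) p q)

end Dominated

/-! ## §2. Cor. 3.5's step with the weighted averaging slot -/

section Step
variable [Fintype X] [Fintype F] [DecidableEq X] [DecidableEq F] {ι : Type} [Fintype ι] {sh : ι → X ≃ X} {η : ℝ} {w : X → ℝ}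
variable [∀ i, NeZero (Kv i)]
variable {dd N' : ℕ} {E : Type*} [NormedAddCommGroup E] [NormedSpace ℂ E]

/-- **[B9] COR. 3.5's STEP UNDER LEVEL-WEIGHTED WINDOWS WITH THE COVARIANT-AVERAGING SLOT.**  As
`D4WalkBlockShiftWeighted.blockWalkExpansion_covShiftW_of_letters` with the perturbation `V_W(u) + Ã(u)(w² ⊗ 1)`, `Ã` holomorphic,
cube-local, full row sums `≤ α_av`; margin `c_μ(c_μ·1·(1·((0 + Σ_j covAlphaW α (α′ + α_av) j·covBW ρ Λ j)C))c_μ)c_μ < 1`.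
[cite: Balaban1985BackgroundPropagators, Cor. 3.5 p.407, (3.78) p.406, (3.61) p.402, Thm 3.1 (3.42) p.397, (3.37) p.396; Balaban1988RG2Cluster, (1.11) p.5] -/
theorem blockWalkExpansion_covShiftWAv_of_letters (cub : X → UT Kv) (hη : 0 < η) (hw : ∀ x, 0 < w x) {Λ : ℝ} (hΛ : 0 ≤ Λ)
    (hsh : ∀ μ x, tdist1 Kv (cub ((sh μ).symm x)) (cub x) ≤ 1) (hwr : ∀ μ x, w x ≤ Λ * w ((sh μ).symm x))
    (G : Matrix (X × F) (X × F) ℂ) {C ρ : ℝ} (hC : 0 ≤ C) (hρ : 0 ≤ ρ)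
    (hG : ∀ Y Y', blockNorm (fun p : X × F => cub p.1) (fun p : X × F => cub p.1) G Y Y' ≤ C * Real.exp (-(ρ * tdist1 Kv Y Y')))
    (hGw2 : ∀ Y Y', blockNorm (fun p : X × F => cub p.1) (fun p : X × F => cub p.1) (wOp X F (fun x => w x ^ 2) * G) Y Y' ≤
      C * Real.exp (-(ρ * tdist1 Kv Y Y')))
    (hGw1 : ∀ μ Y Y', blockNorm (fun p : X × F => cub p.1) (fun p : X × F => cub p.1) (wOp X F w * (Dfw X F sh η μ * G)) Y Y' ≤
      C * Real.exp (-(ρ * tdist1 Kv Y Y')))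
    (c₀ : B13.Consts) (Xs : Finset (UT Kv)) (R : ℝ) (Wp Wm : ι → E → X → Matrix F F ℂ)
    (Aav : E → Matrix (X × F) (X × F) ℂ) (α α' αav ε μ cμ : ℝ)
    (hWph : ∀ ν x a b, DifferentiableOn ℂ (fun u => Wp ν u x a b) (ball (0 : E) R))
    (hWmh : ∀ ν x a b, DifferentiableOn ℂ (fun u => Wm ν u x a b) (ball (0 : E) R))
    (hAavh : ∀ p q, DifferentiableOn ℂ (fun u => Aav u p q) (ball (0 : E) R)) (hα : 0 ≤ α) (hα' : 0 ≤ α') (hαav : 0 ≤ αav)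
    (hWp : ∀ ν, ∀ u ∈ ball (0 : E) R, ∀ x a, ∑ b, ‖Wp ν u x a b‖ ≤ η * α * w x)
    (hWm : ∀ ν, ∀ u ∈ ball (0 : E) R, ∀ x a, ∑ b, ‖Wm ν u x a b‖ ≤ η * α * w x)
    (hdiv : ∀ u ∈ ball (0 : E) R, ∀ x a, ∑ b, ‖(∑ ν, (Wp ν u x + Wm ν u x)) a b‖ ≤ η ^ 2 * α' * w x ^ 2)
    (hloc : ∀ u p q, Aav u p q ≠ 0 → cub p.1 = cub q.1) (hav : ∀ u ∈ ball (0 : E) R, ∀ p, ∑ q, ‖Aav u p q‖ ≤ αav)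
    (hμ : 0 ≤ μ) (hμε : 2 * μ ≤ ε) (hμκ : 2 * μ ≤ ρ - ε - μ) (hcμ : 0 ≤ cμ)
    (hrow : RowSum (toB6 (torusGeom Kv 0 0 0) 0 True) μ cμ)
    (hq : cμ * (cμ * 1 * (1 * ((0 + ∑ j : Unit ⊕ (ι ⊕ ι), covAlphaW α (α' + αav) j * covBW ρ Λ j) * C)) * cμ) * cμ < 1) :
    ∃ (W : Type) (T : W → (TPt dd N' → ℂ) → E → Matrix (X × F) (X × F) ℂ) (SX' : Set W) (A' : W → ℝ)
      (D' : W → UT Kv → UT Kv → ℝ),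
      BlockWalkExpansion c₀ (fun p : X × F => cub p.1) (fun p : X × F => cub p.1)
        (fun (_ : TPt dd N' → ℂ) u => G * (1 - (covShift X F sh η Wp Wm u + Aav u * wOp X F (fun x => w x ^ 2)) * G)⁻¹) Xs R
        (ε - 2 * μ) (ρ - ε - μ - 2 * μ)
        (cμ * C * (1 * (1 - cμ * (cμ * 1 * (1 * ((0 + ∑ j : Unit ⊕ (ι ⊕ ι), covAlphaW α (α' + αav) j * covBW ρ Λ j) * C)) *
          cμ) * cμ)⁻¹) * cμ)
        T SX' A' D' (ρ - 2 * μ) ∧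
      (∀ (j : Unit ⊕ (ι ⊕ ι)) ω (σ : TPt dd N' → ℂ), (∀ i, ‖σ i‖ ≤ Real.exp c₀.κ₁) → ∀ u ∈ ball (0 : E) R, ∀ Y Y',
        blockNorm (fun p : X × F => cub p.1) (fun p : X × F => cub p.1) (covDopW X F sh η w j * T ω σ u) Y Y' ≤
          covBW (ι := ι) ρ Λ j * (A' ω * Real.exp (-((ρ - 2 * μ) * D' ω Y Y')))) ∧
      ∀ ω, DomBy (toB6 (torusGeom Kv 0 0 0) 0 True) (D' ω) := by
  have hW := blockWalkExpansion_const (dd := dd) (N' := N') (E := E) c₀ (fun p : X × F => cub p.1) Xs G R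
    (ε := ε) (κ := ρ - ε - μ) (ρ := ρ) hC (by linarith) hG
  have hD : ∀ (j : Unit ⊕ (ι ⊕ ι)) (ω : Unit) (σ : TPt dd N' → ℂ), (∀ i, ‖σ i‖ ≤ Real.exp c₀.κ₁) → ∀ u ∈ ball (0 : E) R,
      ∀ Y Y' : UT Kv,
        blockNorm (fun p : X × F => cub p.1) (fun p : X × F => cub p.1) (covDopW X F sh η w j * G) Y Y' ≤
          covBW (ι := ι) ρ Λ j * (C * Real.exp (-(ρ * tdist1 Kv Y Y'))) := by
    intro j _ σ _ u _ Y Y'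
    rcases j with v | (ν' | ν')
    · show blockNorm _ _ (wOp X F (fun x => w x ^ 2) * G) Y Y' ≤ 1 * _
      rw [one_mul]; exact hGw2 Y Y'
    · show blockNorm _ _ (wOp X F w * Dfw X F sh η ν' * G) Y Y' ≤ 1 * _
      rw [one_mul, Matrix.mul_assoc]; exact hGw1 ν' Y Y'
    · show blockNorm _ _ (wOp X F w * (Sbw X F sh ν' * Dfw X F sh η ν') * G) Y Y' ≤ Λ * Real.exp ρ * _
      rw [Matrix.mul_assoc, Matrix.mul_assoc]
      have h := blockNorm_wOp_relab_mul_le (F := F) cub ((sh ν').symm : X → X) (hsh ν') hw hΛ (hwr ν') (Dfw X F sh η ν' * G)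
        hC hρ (fun Y Y' => hGw1 ν' Y Y') Y Y'
      calc _ ≤ _ := h
        _ = _ := by ring
  exact blockWalkExpansion_perturb_of_derivLetters (Dop := covDopW X F sh η w) (B := covBW (ι := ι) ρ Λ) hW (fun _ Y Y' => le_rfl)
    (fun j => by rcases j with _ | (_ | _) <;> simp only [covBW] <;> positivity) hD (covShiftWAv_holo hWph hWmh hAavh) le_rfl
    (fun j => by rcases j with _ | (_ | _) <;> simp only [covAlphaW] <;> positivity)
    (covShiftWAv_dominated cub hη hw hα hα' hαav hWp hWm hdiv hloc hav) hμ hμε hμκ (by linarith) hC hcμ hrow hq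

end Step

/-! ## §3. Invertibility of `1 − V(u)G` from the letters, the row sum and the margin -/

section Unit
open scoped Matrix.Norms.Operator

variable {p : Type} [Fintype p] [DecidableEq p] [∀ i, NeZero (Kv i)]

omit [Fintype p] [DecidableEq p] in
/-- A cube row-sum constant is at least one (the diagonal term), on a nonempty carrier. -/
theorem one_le_of_rowSum (cub : p → UT Kv) (i : p) {μ cμ : ℝ} (hrow : RowSum (toB6 (torusGeom Kv 0 0 0) 0 True) μ cμ) :
    1 ≤ cμ := by
  have h : ∑ y' : UT Kv, Real.exp (-(μ * tdist1 Kv (cub i) y')) ≤ cμ := hrow (cub i)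
  refine le_trans (le_trans (le_of_eq ?_) (Finset.single_le_sum (f := fun y' : UT Kv =>
    Real.exp (-(μ * tdist1 Kv (cub i) y'))) (fun y' _ => (Real.exp_pos _).le) (Finset.mem_univ (cub i)))) h
  rw [tdist1_self, mul_zero, neg_zero, Real.exp_zero]

variable [Fintype X] [Fintype F] [DecidableEq X] [DecidableEq F] {ι : Type} [Fintype ι] {sh : ι → X ≃ X} {η : ℝ} {w : X → ℝ}
variable {E : Type*} [NormedAddCommGroup E] [NormedSpace ℂ E]

omit [NormedSpace ℂ E] in
/-- **`1 − V(u)G` IS INVERTIBLE ON THE BALL** for `V = V_W + Ã(w² ⊗ 1)` under the weighted windows, the kernel's value + weighted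
letters at rate `ρ ≥ μ` (the value letter is not needed: the `1`-slot coefficient is `0`), the cube row sum `(μ, c_μ)` and the expansion's margin: the letters of `V(u)G` are
`(Σ_j covAlphaW α (α′ + α_av) j·covBW ρ Λ j)·C·e^{−μd₁}`, and `q < 1` with `c_μ ≥ 1` gives the `ℓ^∞`-Neumann series.
[cite: Balaban1985BackgroundPropagators, (3.62)–(3.64) p.402] -/
theorem isUnit_covShiftWAv_of_letters (cub : X → UT Kv) (hη : 0 < η) (hw : ∀ x, 0 < w x) {Λ : ℝ} (hΛ : 0 ≤ Λ)
    (hsh : ∀ μ x, tdist1 Kv (cub ((sh μ).symm x)) (cub x) ≤ 1) (hwr : ∀ μ x, w x ≤ Λ * w ((sh μ).symm x))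
    (G : Matrix (X × F) (X × F) ℂ) {C ρ : ℝ} (hC : 0 ≤ C) (hρ : 0 ≤ ρ)
    (hGw2 : ∀ Y Y', blockNorm (fun p : X × F => cub p.1) (fun p : X × F => cub p.1) (wOp X F (fun x => w x ^ 2) * G) Y Y' ≤
      C * Real.exp (-(ρ * tdist1 Kv Y Y')))
    (hGw1 : ∀ μ Y Y', blockNorm (fun p : X × F => cub p.1) (fun p : X × F => cub p.1) (wOp X F w * (Dfw X F sh η μ * G)) Y Y' ≤
      C * Real.exp (-(ρ * tdist1 Kv Y Y')))
    (R : ℝ) (Wp Wm : ι → E → X → Matrix F F ℂ) (Aav : E → Matrix (X × F) (X × F) ℂ) {α α' αav μ cμ : ℝ}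
    (hα : 0 ≤ α) (hα' : 0 ≤ α') (hαav : 0 ≤ αav)
    (hWp : ∀ ν, ∀ u ∈ ball (0 : E) R, ∀ x a, ∑ b, ‖Wp ν u x a b‖ ≤ η * α * w x)
    (hWm : ∀ ν, ∀ u ∈ ball (0 : E) R, ∀ x a, ∑ b, ‖Wm ν u x a b‖ ≤ η * α * w x)
    (hdiv : ∀ u ∈ ball (0 : E) R, ∀ x a, ∑ b, ‖(∑ ν, (Wp ν u x + Wm ν u x)) a b‖ ≤ η ^ 2 * α' * w x ^ 2)
    (hloc : ∀ u p q, Aav u p q ≠ 0 → cub p.1 = cub q.1) (hav : ∀ u ∈ ball (0 : E) R, ∀ p, ∑ q, ‖Aav u p q‖ ≤ αav)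
    (hμρ : μ ≤ ρ) (hcμ : 0 ≤ cμ) (hrow : RowSum (toB6 (torusGeom Kv 0 0 0) 0 True) μ cμ)
    (hq : cμ * (cμ * 1 * (1 * ((0 + ∑ j : Unit ⊕ (ι ⊕ ι), covAlphaW α (α' + αav) j * covBW ρ Λ j) * C)) * cμ) * cμ < 1) :
    ∀ u ∈ ball (0 : E) R, IsUnit (1 - (covShift X F sh η Wp Wm u + Aav u * wOp X F (fun x => w x ^ 2)) * G).det := by
  intro u hu
  have hBj : ∀ j : Unit ⊕ (ι ⊕ ι), 0 ≤ covBW (ι := ι) ρ Λ j := fun j => by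
    rcases j with _ | (_ | _) <;> simp only [covBW] <;> positivity
  have hAj : ∀ j : Unit ⊕ (ι ⊕ ι), 0 ≤ covAlphaW (ι := ι) α (α' + αav) j := fun j => by
    rcases j with _ | (_ | _) <;> simp only [covAlphaW] <;> positivity
  -- the weighted letters of `D̃_jG`
  have hD : ∀ (j : Unit ⊕ (ι ⊕ ι)) (Y Y' : UT Kv),
      blockNorm (fun p : X × F => cub p.1) (fun p : X × F => cub p.1) (covDopW X F sh η w j * G) Y Y' ≤
        covBW (ι := ι) ρ Λ j * (C * Real.exp (-(ρ * tdist1 Kv Y Y'))) := by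
    intro j Y Y'
    rcases j with v | (ν' | ν')
    · show blockNorm _ _ (wOp X F (fun x => w x ^ 2) * G) Y Y' ≤ 1 * _
      rw [one_mul]; exact hGw2 Y Y'
    · show blockNorm _ _ (wOp X F w * Dfw X F sh η ν' * G) Y Y' ≤ 1 * _
      rw [one_mul, Matrix.mul_assoc]; exact hGw1 ν' Y Y'
    · show blockNorm _ _ (wOp X F w * (Sbw X F sh ν' * Dfw X F sh η ν') * G) Y Y' ≤ Λ * Real.exp ρ * _
      rw [Matrix.mul_assoc, Matrix.mul_assoc]
      have h := blockNorm_wOp_relab_mul_le (F := F) cub ((sh ν').symm : X → X) (hsh ν') hw hΛ (hwr ν') (Dfw X F sh η ν' * G)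
        hC hρ (fun Y Y' => hGw1 ν' Y Y') Y Y'
      calc _ ≤ _ := h
        _ = _ := by ring
  set B := (∑ j : Unit ⊕ (ι ⊕ ι), covAlphaW α (α' + αav) j * covBW ρ Λ j) * C with hB
  have hB0 : 0 ≤ B := mul_nonneg (Finset.sum_nonneg fun j _ => mul_nonneg (hAj j) (hBj j)) hC
  have hdom := covShiftWAv_dominated (sh := sh) (Wp := Wp) (Wm := Wm) (Aav := Aav) cub hη hw hα hα' hαav hWp hWm hdiv hloc hav u hu
    G
  have hletters : ∀ Y Y', blockNorm (fun p : X × F => cub p.1) (fun p : X × F => cub p.1)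
      ((covShift X F sh η Wp Wm u + Aav u * wOp X F (fun x => w x ^ 2)) * G) Y Y' ≤ B * Real.exp (-(μ * tdist1 Kv Y Y')) := by
    intro Y Y'
    have hd0 := tdist1_nonneg (N := Kv) Y Y'
    have hexp : Real.exp (-(ρ * tdist1 Kv Y Y')) ≤ Real.exp (-(μ * tdist1 Kv Y Y')) := Real.exp_le_exp.2 (by nlinarith)
    calc _ ≤ 0 * blockNorm (fun p : X × F => cub p.1) (fun p : X × F => cub p.1) G Y Y' +
          ∑ j, covAlphaW α (α' + αav) j *
            blockNorm (fun p : X × F => cub p.1) (fun p : X × F => cub p.1) (covDopW X F sh η w j * G) Y Y' := hdom Y Y'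
      _ ≤ 0 + ∑ j, covAlphaW α (α' + αav) j * (covBW (ι := ι) ρ Λ j * (C * Real.exp (-(ρ * tdist1 Kv Y Y')))) := by
          rw [zero_mul]
          exact add_le_add le_rfl (Finset.sum_le_sum fun j _ => mul_le_mul_of_nonneg_left (hD j Y Y') (hAj j))
      _ = B * Real.exp (-(ρ * tdist1 Kv Y Y')) := by
          rw [zero_add, hB, Finset.sum_mul, Finset.sum_mul]; exact Finset.sum_congr rfl fun j _ => by ring
      _ ≤ B * Real.exp (-(μ * tdist1 Kv Y Y')) := mul_le_mul_of_nonneg_left hexp hB0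
  cases isEmpty_or_nonempty (X × F) with
  | inl hE0 => rw [Matrix.det_isEmpty]; exact isUnit_one
  | inr hne =>
      obtain ⟨p0⟩ := hne
      have hcμ1 : 1 ≤ cμ := one_le_of_rowSum (fun p : X × F => cub p.1) p0 hrow
      have hqB : B * cμ < 1 := by
        have e : cμ * (cμ * 1 * (1 * ((0 + ∑ j : Unit ⊕ (ι ⊕ ι), covAlphaW α (α' + αav) j * covBW ρ Λ j) * C)) * cμ) * cμ =
            B * cμ * cμ ^ 3 := by rw [hB]; ring
        rw [e] at hq
        have h1 : B * cμ * 1 ≤ B * cμ * cμ ^ 3 := mul_le_mul_of_nonneg_left (one_le_pow₀ hcμ1) (mul_nonneg hB0 hcμ)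
        linarith
      exact isUnit_one_sub_of_blockLetters (fun p : X × F => cub p.1) _ hB0 hcμ hletters hrow hqB

end Unit

end Summit.QuantumFields.BalabanUV.Gaps.D4WalkBlockShiftWeightedAv

end
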